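import Literature.MathematicalPhysics.QuantumLattice.WilsonCellSchur

/-!
# Route `NestedDissectionSea`, support item `KineticEdge` (stmt-QuantumFields-13899) — helper 1/3:
# the Dirichlet path-graph bound on the four-torus

For a non-negative function `g` on the sites of the torus `(ℤ/N)⁴`, supported in the open site box
`siteBox x s` (coordinate offsets `(y_i − x_i).val ∈ (0, s_i)`), and a direction `μ` with `s_μ ≤ N`:

  `Σ_y g(y) g(y + μ̂) ≤ cos(π / s_μ) · Σ_y g(y)²`     (`sum_mul_shift_le_cos_mul_sum_sq`).

This is the top of the spectrum of the free nearest-neighbour hopping `½(T_μ + T_μᵀ)` on the box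
with Dirichlet sheets: in direction `μ` the box is a path with `s_μ − 1` vertices (the hypothesis
`s_μ ≤ N` excludes the wrapped offset `0`), whose adjacency matrix has top eigenvalue `2 cos(π/s_μ)`
with Perron vector `k ↦ sin(π k/s_μ)` (Brouwer–Haemers, *Spectra of Graphs*, §1.4.4).  Proof by the
ground-state substitution: with `θ(y) = sin(π k(y)/s_μ)`, `k(y) = (y_μ − x_μ).val`, one has `θ > 0`
on the box and `θ(y+μ̂) + θ(y−μ̂) = 2 cos(π/s_μ) θ(y)` there; AM–GM `2ab ≤ a² θ'/θ + b² θ/θ'` on each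
edge of the path and reindexing by the torus translation `y ↦ y + μ̂` give the bound.  Mathlib only.
-/

noncomputable section

open Finset
open Literature.MathematicalPhysics.QuantumLattice Literature.MathematicalPhysics.QuantumFieldTheory
  Literature.Probability.LatticeModels

namespace Summit.QuantumFields.QCD.Theorems.KineticEdge

variable {N : ℕ} [NeZero N]

/-! ### Offsets of the shifted sites `y ± μ̂` for `y` in the box -/

omit [NeZero N] in
/-- A site box containing a site forces `2 ≤ N` along any direction with `s_μ ≤ N`. -/
theorem two_le_of_siteBox {x : TorusSite 4 N} {s : Fin 4 → ℕ} {y : TorusSite 4 N}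
    (hy : siteBox x s y) (μ : Fin 4) (hs : s μ ≤ N) : 2 ≤ N := by
  have h := hy μ
  omega

/-- Forward shift: the `μ`-offset of `y + μ̂` is `(k + 1) mod N`, `k` the `μ`-offset of `y`. -/
theorem val_offset_add_single {x : TorusSite 4 N} {s : Fin 4 → ℕ} {y : TorusSite 4 N}
    (hy : siteBox x s y) (μ : Fin 4) (hs : s μ ≤ N) :
    ((y + Pi.single μ 1 : TorusSite 4 N) μ - x μ).val = ((y μ - x μ).val + 1) % N := by
  haveI : Fact (1 < N) := ⟨two_le_of_siteBox hy μ hs⟩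
  have h1 : (y + Pi.single μ 1 : TorusSite 4 N) μ - x μ = (y μ - x μ) + 1 := by
    rw [Pi.add_apply, Pi.single_eq_same]; abel
  rw [h1, ZMod.val_add, ZMod.val_one]

/-- Backward shift: the `μ`-offset of `y − μ̂` is `k − 1`, `k ≥ 1` the `μ`-offset of `y`. -/
theorem val_offset_sub_single {x : TorusSite 4 N} {s : Fin 4 → ℕ} {y : TorusSite 4 N}
    (hy : siteBox x s y) (μ : Fin 4) (hs : s μ ≤ N) :
    ((y - Pi.single μ 1 : TorusSite 4 N) μ - x μ).val = (y μ - x μ).val - 1 := by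
  haveI : Fact (1 < N) := ⟨two_le_of_siteBox hy μ hs⟩
  have h1 : (y - Pi.single μ 1 : TorusSite 4 N) μ - x μ = (y μ - x μ) - 1 := by
    rw [Pi.sub_apply, Pi.single_eq_same, sub_right_comm]
  have hle : (1 : ZMod N).val ≤ (y μ - x μ).val := by
    rw [ZMod.val_one]; exact (hy μ).1
  rw [h1, ZMod.val_sub hle, ZMod.val_one]

/-! ### The Perron weight `θ(y) = sin(π k(y) / s_μ)` -/

omit [NeZero N] in
/-- `θ > 0` on the box: `0 < π k / s_μ < π` for `0 < k < s_μ`. -/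
theorem sin_offset_pos {x : TorusSite 4 N} {s : Fin 4 → ℕ} {y : TorusSite 4 N}
    (hy : siteBox x s y) (μ : Fin 4) :
    0 < Real.sin (Real.pi * ((y μ - x μ).val : ℝ) / s μ) := by
  obtain ⟨h0, h1⟩ := hy μ
  have hs : (0 : ℝ) < s μ := by exact_mod_cast (Nat.zero_lt_of_lt h1)
  have hk0 : (0 : ℝ) < (y μ - x μ).val := by exact_mod_cast h0
  have hk1 : ((y μ - x μ).val : ℝ) < s μ := by exact_mod_cast h1
  apply Real.sin_pos_of_pos_of_lt_pi
  · positivity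
  · rw [div_lt_iff₀ hs]
    nlinarith [Real.pi_pos]

/-- Forward weight on the box: `θ(y + μ̂) = sin(π (k + 1) / s_μ)` (the wrapped case `k + 1 = N`
forces `s_μ = N`, where both sides vanish). -/
theorem sin_offset_add_single {x : TorusSite 4 N} {s : Fin 4 → ℕ} {y : TorusSite 4 N}
    (hy : siteBox x s y) (μ : Fin 4) (hs : s μ ≤ N) :
    Real.sin (Real.pi * (((y + Pi.single μ 1 : TorusSite 4 N) μ - x μ).val : ℝ) / s μ) =
      Real.sin (Real.pi * (((y μ - x μ).val : ℝ) + 1) / s μ) := by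
  rw [val_offset_add_single hy μ hs]
  obtain ⟨-, h1⟩ := hy μ
  rcases Nat.lt_or_ge ((y μ - x μ).val + 1) N with hlt | hge
  · rw [Nat.mod_eq_of_lt hlt]
    push_cast
    ring_nf
  · -- wrapped: `k + 1 = N = s μ`, both sides vanish
    have hN : (y μ - x μ).val + 1 = N := by omega
    have hsN : ((y μ - x μ).val : ℝ) + 1 = s μ := by exact_mod_cast (show _ = s μ by omega)
    rw [hN, Nat.mod_self, Nat.cast_zero, mul_zero, zero_div, Real.sin_zero, hsN]
    have hs0 : (s μ : ℝ) ≠ 0 := by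
      have : 0 < s μ := by omega
      exact_mod_cast this.ne'
    rw [mul_div_assoc, div_self hs0, mul_one, Real.sin_pi]

/-- Backward weight on the box: `θ(y − μ̂) = sin(π (k − 1) / s_μ)`. -/
theorem sin_offset_sub_single {x : TorusSite 4 N} {s : Fin 4 → ℕ} {y : TorusSite 4 N}
    (hy : siteBox x s y) (μ : Fin 4) (hs : s μ ≤ N) :
    Real.sin (Real.pi * (((y - Pi.single μ 1 : TorusSite 4 N) μ - x μ).val : ℝ) / s μ) =
      Real.sin (Real.pi * (((y μ - x μ).val : ℝ) - 1) / s μ) := by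
  rw [val_offset_sub_single hy μ hs, Nat.cast_sub (hy μ).1, Nat.cast_one]

omit [NeZero N] in
/-- The forward and backward weights are non-negative on the box (angles in `[0, π]`). -/
theorem sin_offset_succ_nonneg {x : TorusSite 4 N} {s : Fin 4 → ℕ} {y : TorusSite 4 N}
    (hy : siteBox x s y) (μ : Fin 4) :
    0 ≤ Real.sin (Real.pi * (((y μ - x μ).val : ℝ) + 1) / s μ) ∧
      0 ≤ Real.sin (Real.pi * (((y μ - x μ).val : ℝ) - 1) / s μ) := by
  obtain ⟨h0, h1⟩ := hy μ
  have hs : (0 : ℝ) < s μ := by exact_mod_cast (Nat.zero_lt_of_lt h1)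
  have hk0 : (1 : ℝ) ≤ (y μ - x μ).val := by exact_mod_cast h0
  have hk1 : ((y μ - x μ).val : ℝ) + 1 ≤ s μ := by exact_mod_cast h1
  constructor
  · apply Real.sin_nonneg_of_nonneg_of_le_pi
    · positivity
    · rw [div_le_iff₀ hs]; nlinarith [Real.pi_pos]
  · apply Real.sin_nonneg_of_nonneg_of_le_pi
    · apply div_nonneg _ hs.le
      nlinarith [Real.pi_pos]
    · rw [div_le_iff₀ hs]; nlinarith [Real.pi_pos]

/-- **Harmonicity of the Perron weight**: `sin(π(k+1)/s) + sin(π(k−1)/s) = 2 cos(π/s) sin(πk/s)`. -/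
theorem sin_succ_add_sin_pred (k s : ℝ) :
    Real.sin (Real.pi * (k + 1) / s) + Real.sin (Real.pi * (k - 1) / s) =
      2 * Real.cos (Real.pi / s) * Real.sin (Real.pi * k / s) := by
  have h1 : Real.pi * (k + 1) / s = Real.pi * k / s + Real.pi / s := by ring
  have h2 : Real.pi * (k - 1) / s = Real.pi * k / s - Real.pi / s := by ring
  rw [h1, h2, Real.sin_add, Real.sin_sub]
  ring

/-! ### The path bound -/

/-- AM–GM on an edge: `2ab ≤ a² (q/p) + b² (p/q)` for `p, q > 0`. -/
theorem two_mul_le_of_pos (a b : ℝ) {p q : ℝ} (hp : 0 < p) (hq : 0 < q) :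
    2 * (a * b) ≤ a ^ 2 * (q / p) + b ^ 2 * (p / q) := by
  have key : a ^ 2 * (q / p) + b ^ 2 * (p / q) - 2 * (a * b) = (a * q - b * p) ^ 2 / (p * q) := by
    field_simp
    ring
  have : 0 ≤ (a * q - b * p) ^ 2 / (p * q) := div_nonneg (sq_nonneg _) (mul_pos hp hq).le
  linarith

/-- **The Dirichlet path-graph bound on the torus.** For `g ≥ 0` supported in the open site box
`siteBox x s` and a direction `μ` with `s_μ ≤ N`:
`Σ_y g(y) g(y + μ̂) ≤ cos(π/s_μ) Σ_y g(y)²` (top eigenvalue `2cos(π/s_μ)` of the path with `s_μ − 1`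
vertices; Brouwer–Haemers §1.4.4, here by the ground-state substitution). -/
theorem sum_mul_shift_le_cos_mul_sum_sq (x : TorusSite 4 N) (s : Fin 4 → ℕ) (μ : Fin 4)
    (hs : s μ ≤ N) (g : TorusSite 4 N → ℝ) (hg : ∀ y, ¬ siteBox x s y → g y = 0) :
    ∑ y, g y * g (y + Pi.single μ 1) ≤ Real.cos (Real.pi / s μ) * ∑ y, g y ^ 2 := by
  -- notation
  set e : TorusSite 4 N := Pi.single μ 1 with he
  set c : ℝ := Real.cos (Real.pi / s μ) with hc
  let θ : TorusSite 4 N → ℝ := fun y => Real.sin (Real.pi * ((y μ - x μ).val : ℝ) / s μ)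
  let B : TorusSite 4 N → Prop := fun y => siteBox x s y
  -- the two halves of the AM–GM bound, and the reindexed second half
  let P : TorusSite 4 N → ℝ := fun y =>
    if B y ∧ B (y + e) then g y ^ 2 * (θ (y + e) / θ y) else 0
  let Q : TorusSite 4 N → ℝ := fun y =>
    if B y ∧ B (y + e) then g (y + e) ^ 2 * (θ y / θ (y + e)) else 0
  let Q' : TorusSite 4 N → ℝ := fun z =>
    if B (z - e) ∧ B z then g z ^ 2 * (θ (z - e) / θ z) else 0
  -- Step 1: AM–GM on every edge of the path
  have h1 : ∀ y, 2 * (g y * g (y + e)) ≤ P y + Q y := by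
    intro y
    by_cases hB : B y ∧ B (y + e)
    · simp only [P, Q, if_pos hB]
      exact two_mul_le_of_pos (g y) (g (y + e)) (sin_offset_pos hB.1 μ) (sin_offset_pos hB.2 μ)
    · simp only [P, Q, if_neg hB, add_zero]
      rcases not_and_or.mp hB with h | h
      · rw [hg y h]; simp
      · rw [hg (y + e) h]; simp
  -- Step 2: reindex the second half by the torus translation `y ↦ y + μ̂`
  have h2 : ∑ y, Q y = ∑ z, Q' z := by
    have hQ : ∀ y, Q y = Q' (y + e) := fun y => by
      simp only [Q, Q', add_sub_cancel_right, and_comm]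
    simp_rw [hQ]
    exact Equiv.sum_comp (Equiv.addRight e) Q'
  -- Step 3: collect at each vertex of the box
  have h3 : ∀ y, P y + Q' y ≤ if B y then g y ^ 2 * (2 * c) else 0 := by
    intro y
    by_cases hBy : B y
    · have hθ : 0 < θ y := sin_offset_pos hBy μ
      have hfw : θ (y + e) = Real.sin (Real.pi * (((y μ - x μ).val : ℝ) + 1) / s μ) :=
        sin_offset_add_single hBy μ hs
      have hbw : θ (y - e) = Real.sin (Real.pi * (((y μ - x μ).val : ℝ) - 1) / s μ) :=
        sin_offset_sub_single hBy μ hs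
      obtain ⟨hf0, hb0⟩ := sin_offset_succ_nonneg hBy μ
      have hsum : θ (y + e) + θ (y - e) = 2 * c * θ y := by
        rw [hfw, hbw, hc]
        exact sin_succ_add_sin_pred _ _
      have hP : P y ≤ g y ^ 2 * (θ (y + e) / θ y) := by
        simp only [P]
        split_ifs
        · exact le_rfl
        · rw [hfw]; positivity
      have hQ' : Q' y ≤ g y ^ 2 * (θ (y - e) / θ y) := by
        simp only [Q']
        split_ifs
        · exact le_rfl
        · rw [hbw]; positivity
      rw [if_pos hBy]
      calc P y + Q' y ≤ g y ^ 2 * (θ (y + e) / θ y) + g y ^ 2 * (θ (y - e) / θ y) :=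
            add_le_add hP hQ'
        _ = g y ^ 2 * ((θ (y + e) + θ (y - e)) / θ y) := by ring
        _ = g y ^ 2 * (2 * c) := by rw [hsum, mul_div_assoc, div_self hθ.ne', mul_one]
    · have hP : P y = 0 := by simp only [P]; rw [if_neg (fun h => hBy h.1)]
      have hQ' : Q' y = 0 := by simp only [Q']; rw [if_neg (fun h => hBy h.2)]
      rw [hP, hQ', if_neg hBy, add_zero]
  -- Step 4: the indicator is redundant since `g` vanishes off the box
  have h4 : ∀ y, (if B y then g y ^ 2 * (2 * c) else 0) = 2 * c * g y ^ 2 := by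
    intro y
    split_ifs with hBy
    · ring
    · rw [hg y hBy]; ring
  -- assemble
  have hmain : 2 * ∑ y, g y * g (y + e) ≤ 2 * (c * ∑ y, g y ^ 2) :=
    calc 2 * ∑ y, g y * g (y + e) = ∑ y, 2 * (g y * g (y + e)) := by rw [Finset.mul_sum]
      _ ≤ ∑ y, (P y + Q y) := Finset.sum_le_sum fun y _ => h1 y
      _ = ∑ y, (P y + Q' y) := by
          rw [Finset.sum_add_distrib, Finset.sum_add_distrib, h2]
      _ ≤ ∑ y, (if B y then g y ^ 2 * (2 * c) else 0) := Finset.sum_le_sum fun y _ => h3 y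
      _ = ∑ y, 2 * c * g y ^ 2 := Finset.sum_congr rfl fun y _ => h4 y
      _ = 2 * (c * ∑ y, g y ^ 2) := by rw [Finset.mul_sum, Finset.mul_sum]; simp_rw [mul_assoc]
  linarith

end Summit.QuantumFields.QCD.Theorems.KineticEdge

end
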